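import Summits.QuantumFields.BalabanUV.Beta.EriceRemainderEnclosureHistoryAutonomyComparisonNonlinearMarkov
import Summits.QuantumFields.BalabanUV.Beta.EriceRemainderEnclosureHistoryAutonomyComparisonNonlinearRelativeSize

/-!
# EriceRemainderEnclosureHistoryAutonomyComparisonNonlinearMarkovLevel — (E126) **COMPARISON WITH AN ARBITRARY MARKOV WEIGHT AND AN ARBITRARY MODULUS FROM DEEP PINS:
# `(L_0 + ME)·(k−1)·h_m³ ≤ 1∕5` along the base orbit** — the relative form of (E122c) `le_of_small_modulus_excess_markov`.  `B u = β₀ + Σ_{k<K} L_k·u_k` (`β₀ > 0`,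
# `L ≥ 0`, the MARKOV weight `L_0 ≥ 0` FREE; profile, range, sizes, loads ARBITRARY); `B′ ≥ B` with a modulus, the excess ISOTONE of modulus `ME` along ordered pairs
# (any size).  (E122c) priced the modulus-route extra `ξ = (L_0 + ME)·h_m³∕2` (`m = n+k+1`; (E122b) `conf_incr_ge_markov`) against a spare twentieth through
# `(L_0 + ME)·γ ≤ β₀∕5` — a condition on the BOX.  Written as `ξ = [(L_0 + ME)·h_m∕2]·h_m²` it is an extra of relative-size type, and (E124) `defect_level_le` prices it
# as soon as `(L_0 + ME)·(h_m∕2)·(k−1) ≤ a_m∕10`, i.e. **`(L_0 + ME)·(k−1)·h_m³ ≤ 1∕5` at the depths `m ≥ k+1` of every loaded age `2 ≤ k < K`** — a condition on the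
# ORBIT that only improves with depth (so it suffices at `m = k+1`, and a fortiori `(L_0 + ME)·(K−2)·p³ ≤ 1∕5` at the pin).  The base of the induction is the generic
# (E122a) `base_gauge_of_defect`, whose price `ξ_k ≤ (β₀∕10)·h_{n+1}²` holds AUTOMATICALLY deep enough (`(L_0 + ME)·h_{n+2} ≤ β₀∕5` — levels grow at least like `n·β₀`,
# **`exists_depth_le`**), so NO global smallness is needed.  Results: (**`gauge_step_markov_level`**, **`base_gauge_markov_level`**, **`steps_nonneg_gauge_markov_level`**)
# the induction; (**`effective_le_markov_level`**) ordering at every orbit pin; (**`le_of_modulus_excess_markov_level`**, family-free) `h′ ≤ h` at every scale;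
# (**`le_of_modulus_excess_markov_uv`**) the UV corollary **`(L_0 + ME)·(K−2)·p³ ≤ 1∕5`: FROM A DEEP ENOUGH PIN EVERY ISOTONE EXCESS WITH A MODULUS COMPARES, WHATEVER
# THE MARKOV WEIGHT** — the threshold pin depends on `L_0 + ME` and `K` only (g98∕g99 §4 (2′) «arbitrary Markov weight», in the ultraviolet).  Contains (E122c) (`h_m ≤ γ`,
# `(k−1)·h_m² ≤ (k−1)∕((k+1)β₀)·… ` — precisely: `(L_0+ME)γ ≤ β₀∕5` and `a_m ≥ (k+1)β₀` give `(L_0+ME)(k−1)h_m³ ≤ (β₀∕5)(k−1)h_m² ≤ (k−1)∕(5(k+1)) ≤ 1∕5`).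

Cell `pub-balaban`, β-function sub-cell, BINDER row D4 «RemainderConst leaves for Bałaban's split» (`HOME/BINDER-OWNERS.md`; owner lineage `b2b-balaban-beta-an4`;
this file by co-owner #2 lineage `b2b-balaban-beta-d4-p2`, generation 100), β-FLOW TEAM duty (1), FREEZE (0) honoured (def-free; imports (E122c), (E124); uses (E118a)
`affine_facts`, (E118c) `exists_base_depth`, (E119b) `excess_facts` ∕ `cmp_of_steps_nonneg` ∕ `excess_orbit_antitone`, (E121d) `gauge_step_of_defect`, (E122a)
`base_gauge_of_defect`, (E122b) `conf_incr_ge_markov`, (E124) `defect_level_le`, (E49j) `effective_le_of_small_pin`, (E49k) `family_le_of_orbit`, (E39) `exists_memFlow_zm`,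
(E43b) `memFlow_unique_of_monotone_zm`, (E48a) `family_mem` ∕ `family_zero` ∕ `family_tail_eq` ∕ `strictAnti_of_memFlow`, node U2's `invSq_eq_of_memFlow` ∕ `mul_lower_le_drive`
BY NAME; §2–§3 are (E122c)'s proofs re-run — nothing else restated).

HONEST FRAMING (page 1, verbatim and binding).  *"Discharging BetaPertH makes Bałaban's UV stability UNCONDITIONAL — a real constructive-QFT result; it is
NOT the continuum limit and NOT the Clay problem."*  THIS FILE DISCHARGES NOTHING OF THE KIND.  Elementary real analysis about ABSTRACT functionals on a box
]0,γ]^ℕ with displayed floors, moduli, profiles and signs — hypotheses of a census, not facts; the form, signs, ages and moments of Bałaban's (1.22) limit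
functional are NOT PRINTED ([I] p. 298; GAPS G-t4-U2-1∕-2) and NOT asserted.  Row D4 class UNCHANGED (critical-path width 0; instance 0∕1; D4 DISCHARGE NO
DATE).  HONEST DEPENDENCY: continuum YM on T⁴ ⇐ BetaPertH ∧ nine spine estimates (0/9 proved); BetaPertH ⇐ (D1) ∧ (D4) ∧ CAP+tail; G-an2-4 gates asym, D1
and NE2/3/4.  NOT CLAIMED: pins above the threshold `(L_0+ME)(K−2)p³ ≤ 1∕5` with a Markov weight (g98 §4 (2): damped sandwich), steep excesses without a modulus
together with a Markov weight, anything printed — NOT B12 Thm 2, NOT BetaPertH, NOT continuum, NOT Clay.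

WHAT IS PROVED ([folklore]; 0 `def`, 0 sorry).  §1 `exists_depth_le`, **`gauge_step_markov_level`**, **`base_gauge_markov_level`**.  §2 **`steps_nonneg_gauge_markov_level`**.
§3 **`effective_le_markov_level`**, **`le_of_modulus_excess_markov_level`**, **`le_of_modulus_excess_markov_uv`**.
-/

noncomputable section
open Finset Set

namespace Summit.QuantumFields.BalabanUV.Beta.EriceRemainderEnclosureHistoryAutonomyComparisonNonlinearMarkovLevel

open Literature.MathematicalPhysics.QuantumFieldTheory.Balaban1983to89
open Literature.MathematicalPhysics.QuantumFieldTheory.Balaban1983to89.T4BetaStationary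
open Literature.MathematicalPhysics.QuantumFieldTheory.Balaban1983to89.T4BetaFlowWellPosed
open Summit.QuantumFields.BalabanUV.Beta.EriceRemainderEnclosureHistoryAutonomyOrder (family_mem family_zero family_tail_eq strictAnti_of_memFlow)
open Summit.QuantumFields.BalabanUV.Beta.EriceRemainderEnclosureHistoryAutonomyComparisonExcess (effective_le_of_small_pin)
open Summit.QuantumFields.BalabanUV.Beta.EriceRemainderEnclosureHistoryAutonomyComparisonIsotoneExcess (family_le_of_orbit)
open Summit.QuantumFields.BalabanUV.Beta.EriceRemainderEnclosureHistoryAutonomyExistence (exists_memFlow_zm)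
open Summit.QuantumFields.BalabanUV.Beta.EriceRemainderEnclosureHistoryAutonomyMonotoneGeneral (memFlow_unique_of_monotone_zm)
open Summit.QuantumFields.BalabanUV.Beta.EriceRemainderEnclosureHistoryAutonomyComparisonNonlinearRowPrep (affine_facts)
open Summit.QuantumFields.BalabanUV.Beta.EriceRemainderEnclosureHistoryAutonomyComparisonNonlinearLevelGaugePrep (exists_base_depth)
open Summit.QuantumFields.BalabanUV.Beta.EriceRemainderEnclosureHistoryAutonomyComparisonNonlinearModulusPrep
  (excess_facts cmp_of_steps_nonneg excess_orbit_antitone)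
open Summit.QuantumFields.BalabanUV.Beta.EriceRemainderEnclosureHistoryAutonomyComparisonNonlinearGaugeDefect (gauge_step_of_defect)
open Summit.QuantumFields.BalabanUV.Beta.EriceRemainderEnclosureHistoryAutonomyComparisonNonlinearBaseDefect (base_gauge_of_defect)
open Summit.QuantumFields.BalabanUV.Beta.EriceRemainderEnclosureHistoryAutonomyComparisonNonlinearMarkovPrep (conf_incr_ge_markov)
open Summit.QuantumFields.BalabanUV.Beta.EriceRemainderEnclosureHistoryAutonomyComparisonNonlinearRelativeSize (defect_level_le)

variable {B B' : (ℕ → ℝ) → ℝ} {γ β₀ M' ME : ℝ} {L : ℕ → ℝ} {K : ℕ} {S S' : ℝ → ℕ → ℝ}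

/-! ## §1 Deep pins are small; the step and the base as instances -/

/-- Along a box solution of a memory with floor `β₀ > 0` the couplings eventually fall below any `c > 0` (levels grow at least like `n·β₀`). [folklore] -/
theorem exists_depth_le (hβ : 0 < β₀) (hlo : ∀ u, SeqBox γ u → β₀ ≤ B u) {h : ℕ → ℝ} {y : ℝ} (hh : SeqBox γ h) (hf : MemFlow B y h)
    {c : ℝ} (hc : 0 < c) : ∃ N : ℕ, ∀ n, N ≤ n → h n ≤ c := by
  obtain ⟨N, hN⟩ := exists_nat_ge (1 / (β₀ * c ^ 2) + 1)
  refine ⟨N, fun n hn => ?_⟩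
  have hpos := (hh n).1
  have hlev : (n : ℝ) * β₀ ≤ 1 / h n ^ 2 := by
    rw [invSq_eq_of_memFlow hf n]
    have h1 := mul_lower_le_drive hlo hh n
    have h2 : 0 ≤ 1 / y ^ 2 := one_div_nonneg.mpr (sq_nonneg y)
    linarith
  have hn' : 1 / (β₀ * c ^ 2) < n := by
    have : (N : ℝ) ≤ n := by exact_mod_cast hn
    linarith
  have h5 : 1 < (n : ℝ) * (β₀ * c ^ 2) := (div_lt_iff₀ (by positivity)).mp hn'
  by_contra hnot
  have hlt : c < h n := lt_of_not_ge hnot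
  have hc2 : c ^ 2 < h n ^ 2 := by nlinarith
  have h2 : 1 / h n ^ 2 < 1 / c ^ 2 := one_div_lt_one_div_of_lt (by positivity) hc2
  have h3 : (n : ℝ) * β₀ < 1 / c ^ 2 := hlev.trans_lt h2
  have h4 : (n : ℝ) * β₀ * c ^ 2 < 1 := (lt_div_iff₀ (by positivity)).mp h3
  nlinarith

set_option maxHeartbeats 800000 in
/-- **THE STEP OF THE ROW INDUCTION, Markov weight and modulus arbitrary, under `(L_0 + ME)·(k−1)·h_m³ ≤ 1∕5` (`2 ≤ k < K`, `m ≥ k+1`) along the base orbit.**  If `X_m ≥ 0`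
and `G_{m+1} ≤ G_m` for `m ≥ n+1` then `G_{n+1} + (e_n − e_{n+1})·h_n² ≤ G_n` ((E121d) `gauge_step_of_defect` with (E122b) `conf_incr_ge_markov`'s defect `θ = F + (L_0 +
ME)·h³∕2`, priced by (E124) `defect_level_le` at the relative size `(L_0 + ME)·h_m∕2`). [folklore] -/
theorem gauge_step_markov_level (hBaff : ∀ u, SeqBox γ u → B u = β₀ + ∑ k ∈ range K, L k * u k) (hL : ∀ k, 0 ≤ L k) (hβ : 0 < β₀)
    (hB' : ∀ u u' : ℕ → ℝ, SeqBox γ u → SeqBox γ u' → ∀ D : ℝ, (∀ j, |u j - u' j| ≤ D) → |B' u - B' u'| ≤ M' * D) (hM' : 0 ≤ M')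
    (hexc : ∀ u, SeqBox γ u → B u ≤ B' u)
    (hDmono : ∀ u v : ℕ → ℝ, SeqBox γ u → SeqBox γ v → (∀ j, u j ≤ v j) → B' u - B u ≤ B' v - B v)
    (hEmod : ∀ u u' : ℕ → ℝ, SeqBox γ u → SeqBox γ u' → (∀ j, u' j ≤ u j) → ∀ D : ℝ, 0 ≤ D → (∀ j, u j - u' j ≤ D) →
      (B' u - B u) - (B' u' - B u') ≤ ME * D) (hME : 0 ≤ ME)
    (hS : ∀ p, 0 < p → p ≤ γ → SeqBox γ (S p) ∧ MemFlow B p (S p))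
    (huniq : ∀ p, 0 < p → p ≤ γ → ∀ u u' : ℕ → ℝ, SeqBox γ u → SeqBox γ u' → MemFlow B p u → MemFlow B p u' → u = u')
    (hS' : ∀ p, 0 < p → p ≤ γ → SeqBox γ (S' p) ∧ MemFlow B' p (S' p))
    (huniq' : ∀ p, 0 < p → p ≤ γ → ∀ u u' : ℕ → ℝ, SeqBox γ u → SeqBox γ u' → MemFlow B' p u → MemFlow B' p u' → u = u')
    {y : ℝ} (hy : 0 < y) (hyγ : y ≤ γ)
    (hlev : ∀ m k, 2 ≤ k → k < K → k + 1 ≤ m → (L 0 + ME) * ((k : ℝ) - 1) * S y m ^ 3 ≤ 1 / 5) (n : ℕ)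
    (hX : ∀ m, n + 1 ≤ m → 0 ≤ B' (S' (S y m)) - B (S (S y m)))
    (hg : ∀ m, n + 1 ≤ m → (B' (S' (S y (m + 1))) - B (S (S y (m + 1)))) * S y (m + 1) ^ 2 ≤ (B' (S' (S y m)) - B (S (S y m))) * S y m ^ 2) :
    (B' (S' (S y (n + 1))) - B (S (S y (n + 1)))) * S y (n + 1) ^ 2
        + ((B' (S' (S y n)) - B (S' (S y n))) - (B' (S' (S y (n + 1))) - B (S' (S y (n + 1))))) * S y n ^ 2
      ≤ (B' (S' (S y n)) - B (S (S y n))) * S y n ^ 2 := by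
  obtain ⟨hmono', hlo'⟩ := excess_facts hBaff hL hβ hexc hDmono
  obtain ⟨hmono, hlo, _, _⟩ := affine_facts hBaff hL hβ
  have hh := (hS y hy hyγ).1
  have hf := (hS y hy hyγ).2
  have hpos : ∀ j, 0 < S y j := fun j => (hh j).1
  have hLM0 : 0 ≤ L 0 + ME := add_nonneg (hL 0) hME
  have hcmp := cmp_of_steps_nonneg hBaff hL hβ hB' hM' hexc hDmono hS huniq hS' huniq' hy hyγ n hX
  -- the defect data
  set ξ : ℕ → ℝ := fun k => (L 0 + ME) * S y (n + k + 1) ^ 3 / 2 with hξ_def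
  set θ : ℕ → ℝ := fun k => ∑ q ∈ Ico 1 K, L q * S y (n + k + 1 + q) ^ 3 / 2 + ξ k with hθ_def
  have hθ0 : ∀ k, 0 ≤ θ k := fun k => by
    have h1 : 0 ≤ ∑ q ∈ Ico 1 K, L q * S y (n + k + 1 + q) ^ 3 / 2 :=
      sum_nonneg fun q _ => by have := hL q; have := hpos (n + k + 1 + q); positivity
    have h2 : 0 ≤ ξ k := by have := hpos (n + k + 1); positivity
    simp only [hθ_def]; linarith
  have hdef : ∀ j, j + 1 < K → (1 / S' (S y (n + 1)) j ^ 2 - 1 / S y (n + 1 + j) ^ 2)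
      - (1 / S' (S y (n + 1)) (j + 1) ^ 2 - 1 / S y (n + 1 + j + 1) ^ 2)
      ≤ θ (j + 1) * (1 / S' (S y (n + 1)) j ^ 2 - 1 / S y (n + 1 + j) ^ 2) := by
    intro j _
    have h := conf_incr_ge_markov hBaff hL hmono' hβ hB' hM' hlo' hEmod hME hS huniq hS' huniq' hy hyγ (n + 1) j (hcmp (n + 1) (by omega))
      (hcmp (n + 1 + 1 + j) (by omega)) (hX (n + 1 + 1 + j) (by omega))
    rw [show n + 1 + 1 + j = n + (j + 1) + 1 by ring] at h
    exact h
  have hθle : ∀ k, 2 ≤ k → k < K → θ k ≤ ∑ q ∈ Ico 1 K, L q * S y (n + k + 1 + q) ^ 3 / 2 + ξ k := fun k _ _ => le_rfl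
  have hprice : ∀ k, 2 ≤ k → k < K → ∀ W : ℝ, 0 ≤ W →
      W ≤ (B' (S' (S y (n + 1))) - B (S (S y (n + 1)))) * S y (n + 1) ^ 2 * ∑ l ∈ Ico 1 k, 1 / S y (n + 1 + l) ^ 2 →
      L k * S y (n + 1 + k) ^ 3 / 2 * ξ k * W ≤ 1 / 20 * (L k * S y (n + 1 + k) * S y (n + 1) ^ 2 * (B' (S' (S y (n + 1))) - B (S (S y (n + 1))))) := by
    intro k hk2 hkK W _ hW
    have hx := hpos (n + k + 1)
    -- the relative size of the modulus-route extra
    set ec : ℝ := (L 0 + ME) * S y (n + k + 1) / 2 with hec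
    have hec0 : 0 ≤ ec := by rw [hec]; positivity
    have hkey : ec * ((k : ℝ) - 1) * (S y (n + k + 1) ^ 2 * 10) ≤ 1 := by
      have h1 := hlev (n + k + 1) k hk2 hkK (by omega)
      have e1 : ec * ((k : ℝ) - 1) * (S y (n + k + 1) ^ 2 * 10) = 5 * ((L 0 + ME) * ((k : ℝ) - 1) * S y (n + k + 1) ^ 3) := by
        rw [hec]; ring
      rw [e1]; linarith
    have hek : ec * ((k : ℝ) - 1) ≤ 1 / S y (n + k + 1) ^ 2 / 10 := by
      rw [div_div, le_div_iff₀ (by positivity)]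
      exact hkey
    have hξ : ξ k = ec * S y (n + k + 1) ^ 2 := by simp only [hξ_def, hec]; ring
    rw [hξ]
    exact defect_level_le (B := B) (L := L) hL hβ hlo hh hf hec0 n (by omega) hek (hX (n + 1) le_rfl) hW
  exact gauge_step_of_defect hBaff hL hβ hB' hM' hexc hDmono hS huniq hS' huniq' hy hyγ n hX hg hθ0 hdef hθle hprice

set_option maxHeartbeats 800000 in
/-- **THE BASE OF THE ROW INDUCTION, Markov weight and modulus arbitrary**: in the deep region (`u_n ≤ 1∕(5(K+1))` and `(L_0 + ME)·h_{n+2} ≤ β₀∕5`), with configurations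
comparing from every pin `h_m`, `m ≥ n`, and `X_m ≥ 0` for `m ≥ n+1`, `G_{n+1} + (e_n − e_{n+1})·h_n² ≤ G_n` ((E122a) `base_gauge_of_defect`: the extra
`(L_0 + ME)·h_{n+k+1}³∕2 ≤ (β₀∕10)·h_{n+1}²` because `h_{n+k+1} ≤ h_{n+2} ∧ h_{n+1}`). [folklore] -/
theorem base_gauge_markov_level (hBaff : ∀ u, SeqBox γ u → B u = β₀ + ∑ k ∈ range K, L k * u k) (hL : ∀ k, 0 ≤ L k) (hβ : 0 < β₀)
    (hB' : ∀ u u' : ℕ → ℝ, SeqBox γ u → SeqBox γ u' → ∀ D : ℝ, (∀ j, |u j - u' j| ≤ D) → |B' u - B' u'| ≤ M' * D) (hM' : 0 ≤ M')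
    (hexc : ∀ u, SeqBox γ u → B u ≤ B' u)
    (hDmono : ∀ u v : ℕ → ℝ, SeqBox γ u → SeqBox γ v → (∀ j, u j ≤ v j) → B' u - B u ≤ B' v - B v)
    (hEmod : ∀ u u' : ℕ → ℝ, SeqBox γ u → SeqBox γ u' → (∀ j, u' j ≤ u j) → ∀ D : ℝ, 0 ≤ D → (∀ j, u j - u' j ≤ D) →
      (B' u - B u) - (B' u' - B u') ≤ ME * D) (hME : 0 ≤ ME)
    (hS : ∀ p, 0 < p → p ≤ γ → SeqBox γ (S p) ∧ MemFlow B p (S p))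
    (huniq : ∀ p, 0 < p → p ≤ γ → ∀ u u' : ℕ → ℝ, SeqBox γ u → SeqBox γ u' → MemFlow B p u → MemFlow B p u' → u = u')
    (hS' : ∀ p, 0 < p → p ≤ γ → SeqBox γ (S' p) ∧ MemFlow B' p (S' p))
    (huniq' : ∀ p, 0 < p → p ≤ γ → ∀ u u' : ℕ → ℝ, SeqBox γ u → SeqBox γ u' → MemFlow B' p u → MemFlow B' p u' → u = u')
    {y : ℝ} (hy : 0 < y) (hyγ : y ≤ γ) (n : ℕ)
    (hu : (1 / S y (n + 1) ^ 2 - 1 / S y n ^ 2) * S y (n + 1) ^ 2 ≤ 1 / (5 * ((K : ℝ) + 1)))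
    (hsmall : (L 0 + ME) * S y (n + 2) ≤ β₀ / 5)
    (hcmp : ∀ m, n ≤ m → ∀ j, S' (S y m) j ≤ S y (m + j)) (hX : ∀ m, n + 1 ≤ m → 0 ≤ B' (S' (S y m)) - B (S (S y m))) :
    (B' (S' (S y (n + 1))) - B (S (S y (n + 1)))) * S y (n + 1) ^ 2
        + ((B' (S' (S y n)) - B (S' (S y n))) - (B' (S' (S y (n + 1))) - B (S' (S y (n + 1))))) * S y n ^ 2
      ≤ (B' (S' (S y n)) - B (S (S y n))) * S y n ^ 2 := by
  obtain ⟨hmono', hlo'⟩ := excess_facts hBaff hL hβ hexc hDmono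
  obtain ⟨hmono, hlo, _, _⟩ := affine_facts hBaff hL hβ
  have hh := (hS y hy hyγ).1
  have hpos : ∀ j, 0 < S y j := fun j => (hh j).1
  have hanti := (strictAnti_of_memFlow hβ hlo hh (hS y hy hyγ).2).antitone
  have hLM0 : 0 ≤ L 0 + ME := add_nonneg (hL 0) hME
  set ξ : ℕ → ℝ := fun k => (L 0 + ME) * S y (n + k + 1) ^ 3 / 2 with hξ_def
  set θ : ℕ → ℝ := fun k => ∑ q ∈ Ico 1 K, L q * S y (n + k + 1 + q) ^ 3 / 2 + ξ k with hθ_def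
  have hξ0 : ∀ k, 0 ≤ ξ k := fun k => by have := hpos (n + k + 1); positivity
  have hθ0 : ∀ k, 0 ≤ θ k := fun k => by
    have h1 : 0 ≤ ∑ q ∈ Ico 1 K, L q * S y (n + k + 1 + q) ^ 3 / 2 :=
      sum_nonneg fun q _ => by have := hL q; have := hpos (n + k + 1 + q); positivity
    have h2 := hξ0 k
    simp only [hθ_def]; linarith
  have hdef : ∀ j, j + 1 < K → (1 / S' (S y (n + 1)) j ^ 2 - 1 / S y (n + 1 + j) ^ 2)
      - (1 / S' (S y (n + 1)) (j + 1) ^ 2 - 1 / S y (n + 1 + j + 1) ^ 2)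
      ≤ θ (j + 1) * (1 / S' (S y (n + 1)) j ^ 2 - 1 / S y (n + 1 + j) ^ 2) := by
    intro j _
    have h := conf_incr_ge_markov hBaff hL hmono' hβ hB' hM' hlo' hEmod hME hS huniq hS' huniq' hy hyγ (n + 1) j (hcmp (n + 1) (by omega))
      (hcmp (n + 1 + 1 + j) (by omega)) (hX (n + 1 + 1 + j) (by omega))
    rw [show n + 1 + 1 + j = n + (j + 1) + 1 by ring] at h
    exact h
  have hθle : ∀ k, 1 ≤ k → k < K → θ k ≤ ∑ q ∈ Ico 1 K, L q * S y (n + k + 1 + q) ^ 3 / 2 + ξ k := fun k _ _ => le_rfl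
  have hξ : ∀ k, 1 ≤ k → k < K → ξ k ≤ β₀ / 10 * S y (n + 1) ^ 2 := by
    intro k hk1 _
    have hx := hpos (n + k + 1)
    have hk2 : S y (n + k + 1) ≤ S y (n + 2) := hanti (by omega)
    have h2k : S y (n + k + 1) ^ 2 ≤ S y (n + 1) ^ 2 := pow_le_pow_left₀ hx.le (hanti (by omega)) 2
    have h3 : (L 0 + ME) * S y (n + k + 1) ≤ β₀ / 5 := (mul_le_mul_of_nonneg_left hk2 hLM0).trans hsmall
    have h4 : (L 0 + ME) * S y (n + k + 1) ^ 3 / 2 = (L 0 + ME) * S y (n + k + 1) * S y (n + k + 1) ^ 2 / 2 := by ring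
    have h5 : (L 0 + ME) * S y (n + k + 1) * S y (n + k + 1) ^ 2 ≤ β₀ / 5 * S y (n + 1) ^ 2 :=
      mul_le_mul h3 h2k (sq_nonneg _) (by positivity)
    simp only [hξ_def]
    rw [h4]; linarith
  exact base_gauge_of_defect hBaff hL hβ hB' hM' hexc hDmono hS huniq hS' huniq' hy hyγ n hu hcmp hX hθ0 hξ0 hdef hθle hξ

/-! ## §2 The nonlinear level gauge along every orbit -/

/-- **THE NONLINEAR LEVEL GAUGE, Markov weight and modulus arbitrary, under `(L_0 + ME)·(k−1)·h_m³ ≤ 1∕5` along the base orbit.**  `B u = β₀ + Σ_{k<K} L_k·u_k` (`β₀ > 0`,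
`L ≥ 0`, `L_0` free); `B′ ≥ B` with modulus `M′`, isotone excess of modulus `ME`; unique solution families.  Along the base orbit `h = S y`: `X_m ≥ 0` and
`X_{m+1}h_{m+1}² ≤ X_mh_m²` at EVERY depth `m` (the deep base needs no hypothesis: `exists_depth_le`). [folklore] -/
theorem steps_nonneg_gauge_markov_level (hBaff : ∀ u, SeqBox γ u → B u = β₀ + ∑ k ∈ range K, L k * u k) (hL : ∀ k, 0 ≤ L k) (hβ : 0 < β₀)
    (hB' : ∀ u u' : ℕ → ℝ, SeqBox γ u → SeqBox γ u' → ∀ D : ℝ, (∀ j, |u j - u' j| ≤ D) → |B' u - B' u'| ≤ M' * D) (hM' : 0 ≤ M')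
    (hexc : ∀ u, SeqBox γ u → B u ≤ B' u)
    (hDmono : ∀ u v : ℕ → ℝ, SeqBox γ u → SeqBox γ v → (∀ j, u j ≤ v j) → B' u - B u ≤ B' v - B v)
    (hEmod : ∀ u u' : ℕ → ℝ, SeqBox γ u → SeqBox γ u' → (∀ j, u' j ≤ u j) → ∀ D : ℝ, 0 ≤ D → (∀ j, u j - u' j ≤ D) →
      (B' u - B u) - (B' u' - B u') ≤ ME * D) (hME : 0 ≤ ME)
    (hS : ∀ p, 0 < p → p ≤ γ → SeqBox γ (S p) ∧ MemFlow B p (S p))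
    (huniq : ∀ p, 0 < p → p ≤ γ → ∀ u u' : ℕ → ℝ, SeqBox γ u → SeqBox γ u' → MemFlow B p u → MemFlow B p u' → u = u')
    (hS' : ∀ p, 0 < p → p ≤ γ → SeqBox γ (S' p) ∧ MemFlow B' p (S' p))
    (huniq' : ∀ p, 0 < p → p ≤ γ → ∀ u u' : ℕ → ℝ, SeqBox γ u → SeqBox γ u' → MemFlow B' p u → MemFlow B' p u' → u = u')
    {y : ℝ} (hy : 0 < y) (hyγ : y ≤ γ)
    (hlev : ∀ m k, 2 ≤ k → k < K → k + 1 ≤ m → (L 0 + ME) * ((k : ℝ) - 1) * S y m ^ 3 ≤ 1 / 5) :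
    ∀ m, 0 ≤ B' (S' (S y m)) - B (S (S y m))
      ∧ (B' (S' (S y (m + 1))) - B (S (S y (m + 1)))) * S y (m + 1) ^ 2 ≤ (B' (S' (S y m)) - B (S (S y m))) * S y m ^ 2 := by
  obtain ⟨hmono, hlo, hdom, hBmod⟩ := affine_facts hBaff hL hβ
  have hM : 0 ≤ ∑ k ∈ range K, L k := sum_nonneg fun k _ => hL k
  have hh := (hS y hy hyγ).1
  have hf := (hS y hy hyγ).2
  have hpos : ∀ j, 0 < S y j := fun j => (hh j).1
  have hLM0 : 0 ≤ L 0 + ME := add_nonneg (hL 0) hME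
  -- the deep region: (E118c)'s, and deep enough that (L_0 + ME)·h_{n+2} ≤ β₀∕5
  obtain ⟨N₀, hN₀⟩ := exists_base_depth hBaff hL hβ hh hf
  have hsmall : ∃ N₁ : ℕ, ∀ n, N₁ ≤ n → (L 0 + ME) * S y (n + 2) ≤ β₀ / 5 := by
    rcases hLM0.eq_or_lt with hz | hposLM
    · exact ⟨0, fun n _ => by rw [← hz, zero_mul]; positivity⟩
    · have hc : 0 < β₀ / 5 / (L 0 + ME) := by positivity
      obtain ⟨N₁, hN₁⟩ := exists_depth_le hβ hlo hh hf hc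
      refine ⟨N₁, fun n hn => ?_⟩
      have := mul_le_mul_of_nonneg_left (hN₁ (n + 2) (by omega)) hLM0
      rwa [mul_div_cancel₀ _ hposLM.ne'] at this
  obtain ⟨N₁, hN₁⟩ := hsmall
  have hXdeep : ∀ m, N₀ ≤ m → 0 ≤ B' (S' (S y m)) - B (S (S y m)) := by
    intro m hm
    have hq := family_mem hS hy hyγ m
    have hsm := (hN₀ m hm).2
    have := effective_le_of_small_pin hBmod hM hβ hlo hexc hDmono hq.1 hq.2 hsm (hS _ hq.1 hq.2).1 (hS _ hq.1 hq.2).2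
      (hS' _ hq.1 hq.2).1 (hS' _ hq.1 hq.2).2
    linarith
  have hΔe : ∀ m, 0 ≤ ((B' (S' (S y m)) - B (S' (S y m))) - (B' (S' (S y (m + 1))) - B (S' (S y (m + 1))))) * S y m ^ 2 := fun m =>
    mul_nonneg (by linarith [(excess_orbit_antitone hBaff hL hβ hB' hM' hexc hDmono hS hS' huniq' hy hyγ m).2]) (sq_nonneg _)
  -- P(n): non-negativity and the gauge at every m ≥ n, from the joint deep region max N₀ N₁
  have hP : ∀ d n, max N₀ N₁ ≤ n + d → ∀ m, n ≤ m → 0 ≤ B' (S' (S y m)) - B (S (S y m))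
      ∧ (B' (S' (S y (m + 1))) - B (S (S y (m + 1)))) * S y (m + 1) ^ 2 ≤ (B' (S' (S y m)) - B (S (S y m))) * S y m ^ 2 := by
    intro d
    induction d with
    | zero =>
      intro n hn m hm
      rw [add_zero] at hn
      have hn0 : N₀ ≤ m := (le_max_left _ _).trans (hn.trans hm)
      have hn1 : N₁ ≤ m := (le_max_right _ _).trans (hn.trans hm)
      refine ⟨hXdeep m hn0, ?_⟩
      have hb := base_gauge_markov_level hBaff hL hβ hB' hM' hexc hDmono hEmod hME hS huniq hS' huniq' hy hyγ m (hN₀ m hn0).1 (hN₁ m hn1)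
        (cmp_of_steps_nonneg hBaff hL hβ hB' hM' hexc hDmono hS huniq hS' huniq' hy hyγ m fun m' hm' => hXdeep m' (by omega))
        fun m' hm' => hXdeep m' (by omega)
      linarith [hΔe m]
    | succ d ih =>
      intro n hn m hm
      have ih' := ih (n + 1) (by omega)
      by_cases hm1 : n + 1 ≤ m
      · exact ih' m hm1
      · have hmn : m = n := by omega
        subst hmn
        have hXb : ∀ m', m + 1 ≤ m' → 0 ≤ B' (S' (S y m')) - B (S (S y m')) := fun m' hm' => (ih' m' hm').1
        have hgb : ∀ m', m + 1 ≤ m' → (B' (S' (S y (m' + 1))) - B (S (S y (m' + 1)))) * S y (m' + 1) ^ 2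
            ≤ (B' (S' (S y m')) - B (S (S y m'))) * S y m' ^ 2 := fun m' hm' => (ih' m' hm').2
        have hgs := gauge_step_markov_level hBaff hL hβ hB' hM' hexc hDmono hEmod hME hS huniq hS' huniq' hy hyγ hlev m hXb hgb
        have hG1 : 0 ≤ (B' (S' (S y (m + 1))) - B (S (S y (m + 1)))) * S y (m + 1) ^ 2 := mul_nonneg (hXb (m + 1) le_rfl) (sq_nonneg _)
        have hm2 : 0 < S y m ^ 2 := pow_pos (hpos m) 2
        refine ⟨?_, by linarith [hΔe m]⟩
        have h1 : 0 ≤ (B' (S' (S y m)) - B (S (S y m))) * S y m ^ 2 := by linarith [hΔe m]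
        nlinarith
  intro m
  exact hP (max N₀ N₁) 0 (by omega) m (Nat.zero_le m)

/-! ## §3 Comparison from deep pins, Markov weight and modulus arbitrary -/

/-- **THE EFFECTIVE β-FUNCTIONS OF `B` AND `B′` ARE ORDERED AT EVERY ORBIT PIN**, `B(S h_i) ≤ B′(S′h_i)` for every `i`, `h = S p` — under
`(L_0 + ME)·(k−1)·h_m³ ≤ 1∕5` (`2 ≤ k < K`, `m ≥ k+1`) along the orbit from `p` (the sub-orbit from `h_i` inherits it at depths `i+m`). [folklore] -/
theorem effective_le_markov_level (hBaff : ∀ u, SeqBox γ u → B u = β₀ + ∑ k ∈ range K, L k * u k) (hL : ∀ k, 0 ≤ L k) (hβ : 0 < β₀)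
    (hB' : ∀ u u' : ℕ → ℝ, SeqBox γ u → SeqBox γ u' → ∀ D : ℝ, (∀ j, |u j - u' j| ≤ D) → |B' u - B' u'| ≤ M' * D) (hM' : 0 ≤ M')
    (hexc : ∀ u, SeqBox γ u → B u ≤ B' u)
    (hDmono : ∀ u v : ℕ → ℝ, SeqBox γ u → SeqBox γ v → (∀ j, u j ≤ v j) → B' u - B u ≤ B' v - B v)
    (hEmod : ∀ u u' : ℕ → ℝ, SeqBox γ u → SeqBox γ u' → (∀ j, u' j ≤ u j) → ∀ D : ℝ, 0 ≤ D → (∀ j, u j - u' j ≤ D) →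
      (B' u - B u) - (B' u' - B u') ≤ ME * D) (hME : 0 ≤ ME)
    {p : ℝ} (hp : 0 < p) (hpγ : p ≤ γ)
    (hS : ∀ p, 0 < p → p ≤ γ → SeqBox γ (S p) ∧ MemFlow B p (S p))
    (huniq : ∀ p, 0 < p → p ≤ γ → ∀ u u' : ℕ → ℝ, SeqBox γ u → SeqBox γ u' → MemFlow B p u → MemFlow B p u' → u = u')
    (hS' : ∀ p, 0 < p → p ≤ γ → SeqBox γ (S' p) ∧ MemFlow B' p (S' p))
    (huniq' : ∀ p, 0 < p → p ≤ γ → ∀ u u' : ℕ → ℝ, SeqBox γ u → SeqBox γ u' → MemFlow B' p u → MemFlow B' p u' → u = u')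
    (hlev : ∀ m k, 2 ≤ k → k < K → k + 1 ≤ m → (L 0 + ME) * ((k : ℝ) - 1) * S p m ^ 3 ≤ 1 / 5) :
    ∀ i, B (S (S p i)) ≤ B' (S' (S p i)) := by
  intro i
  have hq := family_mem hS hp hpγ i
  have htail : ∀ m, S (S p i) m = S p (i + m) := fun m => (congrFun (family_tail_eq hS huniq hp hpγ i) m).symm
  have hlev' : ∀ m k, 2 ≤ k → k < K → k + 1 ≤ m → (L 0 + ME) * ((k : ℝ) - 1) * S (S p i) m ^ 3 ≤ 1 / 5 := by
    intro m k hk2 hkK hkm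
    rw [htail m]
    exact hlev (i + m) k hk2 hkK (by omega)
  have := (steps_nonneg_gauge_markov_level hBaff hL hβ hB' hM' hexc hDmono hEmod hME hS huniq hS' huniq' hq.1 hq.2 hlev' 0).1
  rw [family_zero hS hq.1 hq.2] at this
  linarith

/-- **COMPARISON WITH AN ARBITRARY MARKOV WEIGHT AND MODULUS FROM DEEP PINS, family-free form.**  `B u = β₀ + Σ_{k<K} L_k·u_k` on the box ]0,γ] with `β₀ > 0`,
`L ≥ 0` — the Markov weight `L_0`, the profile, the range `K` and ALL SIZES ARBITRARY; `B′ ≥ B` on the box with a modulus `M′ ≥ 0`, the excess `B′ − B` ISOTONE and of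
modulus `ME ≥ 0` along ordered pairs (any size); `h`, `h′` ANY box solutions of `B`, `B′` from one pin `p ∈ ]0,γ]`; and along the base solution
**`(L_0 + ME)·(k−1)·h_m³ ≤ 1∕5` for `2 ≤ k < K`, `m ≥ k+1`** (it suffices at `m = k+1`).  Then `h′ ≤ h` at EVERY scale.  Contains (E122c) (`(L_0+ME)γ ≤ β₀∕5`, since
`h_m ≤ γ` and `h_m² ≤ 1∕((k+1)β₀)`). [folklore] -/
theorem le_of_modulus_excess_markov_level {p : ℝ} {h h' : ℕ → ℝ} (hBaff : ∀ u, SeqBox γ u → B u = β₀ + ∑ k ∈ range K, L k * u k) (hL : ∀ k, 0 ≤ L k)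
    (hβ : 0 < β₀)
    (hB' : ∀ u u' : ℕ → ℝ, SeqBox γ u → SeqBox γ u' → ∀ D : ℝ, (∀ j, |u j - u' j| ≤ D) → |B' u - B' u'| ≤ M' * D) (hM' : 0 ≤ M')
    (hexc : ∀ u, SeqBox γ u → B u ≤ B' u)
    (hDmono : ∀ u v : ℕ → ℝ, SeqBox γ u → SeqBox γ v → (∀ j, u j ≤ v j) → B' u - B u ≤ B' v - B v)
    (hEmod : ∀ u u' : ℕ → ℝ, SeqBox γ u → SeqBox γ u' → (∀ j, u' j ≤ u j) → ∀ D : ℝ, 0 ≤ D → (∀ j, u j - u' j ≤ D) →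
      (B' u - B u) - (B' u' - B u') ≤ ME * D) (hME : 0 ≤ ME)
    (hp : 0 < p) (hpγ : p ≤ γ) (hh : SeqBox γ h) (hf : MemFlow B p h) (hh' : SeqBox γ h') (hf' : MemFlow B' p h')
    (hlev : ∀ m k, 2 ≤ k → k < K → k + 1 ≤ m → (L 0 + ME) * ((k : ℝ) - 1) * h m ^ 3 ≤ 1 / 5) (j : ℕ) :
    h' j ≤ h j := by
  obtain ⟨hmono', hlo'⟩ := excess_facts hBaff hL hβ hexc hDmono
  obtain ⟨hmono, hlo, _, hBmod⟩ := affine_facts hBaff hL hβ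
  have hM : 0 ≤ ∑ k ∈ range K, L k := sum_nonneg fun k _ => hL k
  have hγ : 0 < γ := hp.trans_le hpγ
  have hex : ∀ q : ℝ, 0 < q → q ≤ γ → ∃ k : ℕ → ℝ, SeqBox γ k ∧ MemFlow B q k := fun q hq hqγ => exists_memFlow_zm hBmod hM hq hqγ hβ hlo
  have hex' : ∀ q : ℝ, 0 < q → q ≤ γ → ∃ k : ℕ → ℝ, SeqBox γ k ∧ MemFlow B' q k := fun q hq hqγ => exists_memFlow_zm hB' hM' hq hqγ hβ hlo'
  choose! S hSb hSf using hex
  choose! S' hS'b hS'f using hex'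
  have hS : ∀ q, 0 < q → q ≤ γ → SeqBox γ (S q) ∧ MemFlow B q (S q) := fun q hq hqγ => ⟨hSb q hq hqγ, hSf q hq hqγ⟩
  have hS' : ∀ q, 0 < q → q ≤ γ → SeqBox γ (S' q) ∧ MemFlow B' q (S' q) := fun q hq hqγ => ⟨hS'b q hq hqγ, hS'f q hq hqγ⟩
  have huniq : ∀ q, 0 < q → q ≤ γ → ∀ u u' : ℕ → ℝ, SeqBox γ u → SeqBox γ u' → MemFlow B q u → MemFlow B q u' → u = u' :=
    fun q hq _ u u' hu hu' hfu hfu' => memFlow_unique_of_monotone_zm hmono hBmod hM hq hβ hlo hu hu' hfu hfu'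
  have huniq' : ∀ q, 0 < q → q ≤ γ → ∀ u u' : ℕ → ℝ, SeqBox γ u → SeqBox γ u' → MemFlow B' q u → MemFlow B' q u' → u = u' :=
    fun q hq _ u u' hu hu' hfu hfu' => memFlow_unique_of_monotone_zm hmono' hB' hM' hq hβ hlo' hu hu' hfu hfu'
  have e : h = S p := huniq p hp hpγ _ _ hh (hS p hp hpγ).1 hf (hS p hp hpγ).2
  have e' : h' = S' p := huniq' p hp hpγ _ _ hh' (hS' p hp hpγ).1 hf' (hS' p hp hpγ).2
  have hlevS : ∀ m k, 2 ≤ k → k < K → k + 1 ≤ m → (L 0 + ME) * ((k : ℝ) - 1) * S p m ^ 3 ≤ 1 / 5 := by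
    intro m k hk2 hkK hkm; have := hlev m k hk2 hkK hkm; rwa [e] at this
  rw [e, e']
  exact family_le_of_orbit hβ hγ hB' hM' hlo' hS huniq hS' huniq' ⟨hp, hpγ⟩ (fun i _ =>
    effective_le_markov_level hBaff hL hβ hB' hM' hexc hDmono hEmod hME hp hpγ hS huniq hS' huniq' hlevS i) j

/-- **THE UV COROLLARY: `(L_0 + ME)·(K−2)·p³ ≤ 1∕5` ⟹ comparison**, whatever the Markov weight, the modulus, the profile and the sizes — from a deep enough pin every
isotone excess with a modulus compares (`h_m < p` along the orbit and `k−1 ≤ K−2`). [folklore] -/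
theorem le_of_modulus_excess_markov_uv {p : ℝ} {h h' : ℕ → ℝ} (hBaff : ∀ u, SeqBox γ u → B u = β₀ + ∑ k ∈ range K, L k * u k) (hL : ∀ k, 0 ≤ L k)
    (hβ : 0 < β₀)
    (hB' : ∀ u u' : ℕ → ℝ, SeqBox γ u → SeqBox γ u' → ∀ D : ℝ, (∀ j, |u j - u' j| ≤ D) → |B' u - B' u'| ≤ M' * D) (hM' : 0 ≤ M')
    (hexc : ∀ u, SeqBox γ u → B u ≤ B' u)
    (hDmono : ∀ u v : ℕ → ℝ, SeqBox γ u → SeqBox γ v → (∀ j, u j ≤ v j) → B' u - B u ≤ B' v - B v)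
    (hEmod : ∀ u u' : ℕ → ℝ, SeqBox γ u → SeqBox γ u' → (∀ j, u' j ≤ u j) → ∀ D : ℝ, 0 ≤ D → (∀ j, u j - u' j ≤ D) →
      (B' u - B u) - (B' u' - B u') ≤ ME * D) (hME : 0 ≤ ME) (hpin : (L 0 + ME) * ((K : ℝ) - 2) * p ^ 3 ≤ 1 / 5)
    (hp : 0 < p) (hpγ : p ≤ γ) (hh : SeqBox γ h) (hf : MemFlow B p h) (hh' : SeqBox γ h') (hf' : MemFlow B' p h') (j : ℕ) :
    h' j ≤ h j := by
  obtain ⟨hmono, hlo, _, _⟩ := affine_facts hBaff hL hβ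
  have hLM0 : 0 ≤ L 0 + ME := add_nonneg (hL 0) hME
  have hanti := (strictAnti_of_memFlow hβ hlo hh hf).antitone
  refine le_of_modulus_excess_markov_level hBaff hL hβ hB' hM' hexc hDmono hEmod hME hp hpγ hh hf hh' hf' (fun m k hk2 hkK _ => ?_) j
  have hm : h m ≤ p := by have := hanti (Nat.zero_le m); rwa [hf.1] at this
  have hm0 : 0 < h m := (hh m).1
  have h3 : h m ^ 3 ≤ p ^ 3 := pow_le_pow_left₀ hm0.le hm 3
  have hk : (k : ℝ) - 1 ≤ (K : ℝ) - 2 := by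
    have : (k : ℝ) + 1 ≤ K := by exact_mod_cast hkK
    linarith
  have hk0 : 0 ≤ (k : ℝ) - 1 := by
    have : (2 : ℝ) ≤ k := by exact_mod_cast hk2
    linarith
  calc (L 0 + ME) * ((k : ℝ) - 1) * h m ^ 3 ≤ (L 0 + ME) * ((K : ℝ) - 2) * p ^ 3 :=
        mul_le_mul (mul_le_mul_of_nonneg_left hk hLM0) h3 (pow_nonneg hm0.le 3) (mul_nonneg hLM0 (hk0.trans hk))
    _ ≤ 1 / 5 := hpin

end Summit.QuantumFields.BalabanUV.Beta.EriceRemainderEnclosureHistoryAutonomyComparisonNonlinearMarkovLevel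

end
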